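import Literature.NumberTheory.Sieve.BombieriFriedlanderIwaniecLemma1Corrected
import Literature.NumberTheory.Sieve.HardyLittlewoodTwinSieveBFIFromLemma1
import Literature.NumberTheory.Sieve.BombieriFriedlanderIwaniecTheorem10FromLemma1
import HarnessLib

/-!
# Bombieri–Friedlander–Iwaniec 1986/2019: Theorems 2, 10 and Corollary 2 from the CORRECTED Lemma 1

Topic `Literature/NumberTheory/Sieve`.  Everything here is PROVED; no named fact and no definition
is introduced.  Sequel to `…Lemma1Corrected` (which see for the story): the tree's reductions of
BFI's Theorem 2 (§9), Theorem 10 (all forms) and Corollary 2 (the twin-prime sieve constant `7/2`)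
to Lemma 1 use the MISPRINTED form of Lemma 1 (`BFI.Lemma1BoundFor`, last term `D²NRS⁻¹`, a false
statement); here they are re-threaded through the corrected Lemma 1 of E. Bombieri,
J. B. Friedlander, H. Iwaniec, *Some corrections to an old paper*, arXiv:1903.01371 (2019), §2,
Lemma 2.1 (last term `D²NR`) — the hypothesis predicate `BFI.Lemma1BoundCorrected BFI.plateau2 (5/4)`
— in fact through its `S = 1/2` instance `BFI.K1HalfFor BFI.plateau2 (5/4)`, the only instance the
printed proofs use ("In most of our uses of this lemma we have `S = 1` so things remain as
before", loc. cit.).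

* Lemma 7 side (§9, pp. 230–231): `BFI.L7.blockB_le_of_K1half`, `BFI.L7.dispBm_le_pos_half`,
  `BFI.L7.dispBm_le_of_K1half` — the proofs of `…DispersionLemma7` verbatim with the hypothesis
  weakened to what they use — and `BFI.lemma7_dispBm_of_K1half`, `BFI.lemma7_dispBm_of_lemma1corr`;
* **Theorem 2** from the corrected Lemma 1: `BombieriFriedlanderIwaniecTheorem2_of_lemma1corr`
  (via the tree's `BFI.BombieriFriedlanderIwaniecTheorem2_of_lemma7`);
* **Theorem 10**: `BFI.Theorem10Dyadic_of_lemma1corr` (dyadic form (15.1)),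
  `BombieriFriedlanderIwaniecTheorem10_of_lemma1corr` (as printed, p. 209),
  `BombieriFriedlanderIwaniecTheorem10Pi_of_lemma1corr` (`π`-form), `bfi_wellFactorable_level_of_lemma1corr`;
* **Corollary 2**: `twinSieve_bfi_of_lemma1corr` (`π₂(x) ≤ (7/2 + ε) · 2C₂ x/log²x`);
* the same from the `S = 1/2` instance alone (`…_of_k1Half`) and from the corrected Lemma 1
  quantified over all smooth weights (`…_of_lemma1corr'`).

After this file, what remains unproved in the tree for `BombieriFriedlanderIwaniecTheorem1/2/5/
5Star/5StarInterval/10/10Pi`, `BFI.Theorem10Dyadic`, `bfi_wellFactorable_level` and `twinSieve_bfi`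
is exactly the corrected Lemma 1 for the weight `w ⊗ w` at `S = 1/2`: Deshouillers–Iwaniec, Invent.
Math. 70 (1982), Theorem 12 (corrected 2019; Kuznetsov's formula and the spectral large sieve on
`Γ₀(rs)∖ℍ`, in neither Mathlib nor the tree).

## References

* E. Bombieri, J. B. Friedlander, H. Iwaniec, *Some corrections to an old paper*, arXiv:1903.01371
  (2019), §2 Lemma 2.1. [BombieriFriedlanderIwaniec2019]
* E. Bombieri, J. B. Friedlander, H. Iwaniec, Acta Math. 156 (1986), 203–251: §2 Lemma 1 p. 210;
  §9 Lemma 7, Theorem 2, pp. 229–231; Theorem 10 and Corollary 2 p. 209; §§15, 17.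
  [BombieriFriedlanderIwaniecActa1986]
* J.-M. Deshouillers, H. Iwaniec, Invent. Math. 70 (1982), 219–288, Theorem 12.
-/

noncomputable section

open Finset Real
open scoped ArithmeticFunction.sigma FourierTransform ComplexConjugate ContDiff

namespace Literature.NumberTheory.Sieve

namespace BFI

namespace L7

/-! ### Lemma 7 from the `S = 1/2` instance (the proofs of `…DispersionLemma7`, hypothesis weakened) -/

/-- **One smoothed block, from the `S = 1/2` instance of Lemma 1** — `BFI.L7.blockB_le_of_K1` with
its hypothesis restricted to `S = 1/2`, which is all its proof uses (BFI pp. 230–231, (9.17)).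
[cite: BombieriFriedlanderIwaniecActa1986, §9 (9.16)–(9.17) p. 230] -/
theorem blockB_le_of_K1half {ε K₁ : ℝ} (hK₁0 : 0 ≤ K₁)
    (hK₁ : ∀ C' D' N R : ℝ, 1 ≤ C' → 1 ≤ D' → 1 ≤ N → 1 / 2 ≤ R →
      ∀ B : ℕ → ℕ → ℕ → ℂ,
        ‖dispK (fun c d => plateau2 (c / C') (d / D')) ⌊5 / 4 * C'⌋₊ ⌊5 / 4 * D'⌋₊ ⌊N⌋₊ R (1 / 2) B‖ ≤
          K₁ * (C' * D' * N * R * (1 / 2)) ^ ε * lemma1I C' D' N R (1 / 2) *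
            lemma1Norm ⌊N⌋₊ R (1 / 2) B)
    {A m K H N : ℕ} (hA : 1 ≤ A) (hm : 0 < m) (hK : 1 ≤ K) (hH : 1 ≤ H) (hN : 1 ≤ N)
    {C' D' : ℝ} (hC' : 1 ≤ C') (hD' : 1 ≤ D') {b : ℕ → ℝ} {β : ℕ → ℕ → ℂ}
    (hβ : ∀ h n, ‖β h n‖ ≤ |b n|) {L : ℕ} (hL : N * N ≤ 2 ^ L) :
    blockB (A : ℤ) m (fun c d => plateau2 (c / C') (d / D')) ⌊5 / 4 * C'⌋₊ ⌊5 / 4 * D'⌋₊ K H N β ≤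
      ((⌊5 / 4 * C'⌋₊ : ℝ) * ⌊5 / 4 * D'⌋₊) *
          (K * H * (1 + Real.log N) * ∑ n ∈ Icc 1 N, (#n.divisors : ℝ) * b n ^ 2) +
        2 * ∑ l ∈ Finset.range (L + 1),
          K₁ * (C' * D' * ((A * K * (H * N) : ℕ) : ℝ) * ((2 : ℝ) ^ l / 2) * (1 / 2)) ^ ε *
            lemma1I C' D' ((A * K * (H * N) : ℕ) : ℝ) ((2 : ℝ) ^ l / 2) (1 / 2) *
            Real.sqrt (∑ y ∈ Icc 1 (A * K * (H * N)) ×ˢ Icc 1 (2 ^ L),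
              ‖BcoefB A m β K H N y‖ ^ 2) := by
  set g : ℕ → ℕ → ℝ := fun c d => plateau2 (c / C') (d / D') with hg
  have hg0 : ∀ c d, 0 ≤ g c d := fun c d => plateau2_nonneg _ _
  set cM : ℕ := ⌊5 / 4 * C'⌋₊
  set dM : ℕ := ⌊5 / 4 * D'⌋₊
  set Nmax : ℕ := A * K * (H * N) with hNmax
  have hN1 : (1 : ℝ) ≤ (Nmax : ℝ) := by
    have : 1 ≤ Nmax := by
      have h1 : 1 * 1 ≤ A * K := Nat.mul_le_mul hA hK
      have h2 : 1 * 1 ≤ H * N := Nat.mul_le_mul hH hN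
      have h3 : 1 * 1 ≤ (A * K) * (H * N) := Nat.mul_le_mul (by simpa using h1) (by simpa using h2)
      simpa [hNmax] using h3
    exact_mod_cast this
  -- the two parts
  have hparts := blockB_le_parts (A : ℤ) hm g cM dM K H N β
  have hZ0 := diag_le (A : ℤ) m hg0 cM dM K H N hβ
  have hG : ∑ c ∈ Icc 1 cM, ∑ d ∈ Icc 1 dM, g c d ≤ (cM : ℝ) * dM :=
    L6.sum_sum_plateau2_le C' D' cM dM
  have hZpos : ‖L6.Zpart (tsetBPos m K H N) (A : ℤ) g cM dM β‖ ≤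
      ∑ l ∈ Finset.range (L + 1),
        K₁ * (C' * D' * (Nmax : ℝ) * ((2 : ℝ) ^ l / 2) * (1 / 2)) ^ ε *
          lemma1I C' D' (Nmax : ℝ) ((2 : ℝ) ^ l / 2) (1 / 2) *
          Real.sqrt (∑ y ∈ Icc 1 Nmax ×ˢ Icc 1 (2 ^ L), ‖BcoefB A m β K H N y‖ ^ 2) := by
    rw [Zpart_pos_eq_sum_dispK hA m g cM dM K H N β hL]
    refine (norm_sum_le _ _).trans (Finset.sum_le_sum fun l hl => ?_)
    have hlL : l ≤ L := Nat.lt_succ_iff.1 (Finset.mem_range.1 hl)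
    have hR : (1 : ℝ) / 2 ≤ (2 : ℝ) ^ l / 2 := by
      have : (1 : ℝ) ≤ (2 : ℝ) ^ l := one_le_pow₀ (by norm_num)
      linarith
    have h := hK₁ C' D' (Nmax : ℝ) ((2 : ℝ) ^ l / 2) hC' hD' hN1 hR
      (fun n r _ => BcoefB A m β K H N (n, r))
    rw [Nat.floor_natCast] at h
    refine h.trans ?_
    refine mul_le_mul_of_nonneg_left (L6.lemma1Norm_block_le Nmax hlL _) ?_
    have : 0 ≤ lemma1I C' D' (Nmax : ℝ) ((2 : ℝ) ^ l / 2) (1 / 2) := Real.sqrt_nonneg _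
    positivity
  have hdiag0 : 0 ≤ (K : ℝ) * H * (1 + Real.log N) * ∑ n ∈ Icc 1 N, (#n.divisors : ℝ) * b n ^ 2 := by
    have : 0 ≤ 1 + Real.log N := by have := Real.log_natCast_nonneg N; linarith
    exact mul_nonneg (by positivity) (Finset.sum_nonneg fun n _ => by positivity)
  calc blockB (A : ℤ) m g cM dM K H N β
      ≤ ‖L6.Zpart (tsetBZero m K H N) (A : ℤ) g cM dM β‖ +
          2 * ‖L6.Zpart (tsetBPos m K H N) (A : ℤ) g cM dM β‖ := hparts
    _ ≤ ((cM : ℝ) * dM) * (K * H * (1 + Real.log N) * ∑ n ∈ Icc 1 N, (#n.divisors : ℝ) * b n ^ 2) +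
        2 * ∑ l ∈ Finset.range (L + 1),
          K₁ * (C' * D' * (Nmax : ℝ) * ((2 : ℝ) ^ l / 2) * (1 / 2)) ^ ε *
            lemma1I C' D' (Nmax : ℝ) ((2 : ℝ) ^ l / 2) (1 / 2) *
            Real.sqrt (∑ y ∈ Icc 1 Nmax ×ˢ Icc 1 (2 ^ L), ‖BcoefB A m β K H N y‖ ^ 2) := by
        have h1 : ‖L6.Zpart (tsetBZero m K H N) (A : ℤ) g cM dM β‖ ≤
            ((cM : ℝ) * dM) * (K * H * (1 + Real.log N) * ∑ n ∈ Icc 1 N, (#n.divisors : ℝ) * b n ^ 2) :=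
          hZ0.trans (mul_le_mul_of_nonneg_right hG hdiag0)
        linarith

set_option maxHeartbeats 2000000 in
-- the final assembly of Lemma 7 (long but elementary bookkeeping), verbatim from `…DispersionLemma7`
/-- **BFI Lemma 7 for `𝓑_m` and `a = A ≥ 1` from the `S = 1/2` instance of Lemma 1** (§9, (9.15),
pp. 230–231), uniformly in `m ≥ 1` — the statement and proof of `BFI.L7.dispBm_le_pos`, with the
hypothesis weakened to `BFI.K1HalfFor BFI.plateau2 (5/4)`.
[cite: BombieriFriedlanderIwaniecActa1986, §9 Lemma 7 p. 230] -/
theorem dispBm_le_pos_half (hLB : K1HalfFor plateau2 (5 / 4)) {A : ℕ} (hA : 1 ≤ A) {η : ℝ}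
    (hη : 0 < η) :
    ∃ C₇ : ℝ, ∀ m : ℕ, 0 < m → ∀ C D K H N : ℝ, 1 ≤ C → 1 ≤ D → 1 ≤ K → 1 ≤ H → 1 ≤ N →
      ∀ (b : ℕ → ℝ) (β : ℕ → ℕ → ℂ), (∀ h n, ‖β h n‖ ≤ |b n|) →
        dispBm (A : ℤ) m C D K H N β ≤
          C₇ * ((C * D * K * H * N) ^ η * (C * D * H * K * ∑ n ∈ Icc 1 ⌊N⌋₊, b n ^ 2 +
            (bracket7 C D K H N) ^ (1 / 2 : ℝ) *
              (H ^ 2 * (H * K + N) * ∑ n ∈ Icc 1 ⌊N⌋₊, (rho n : ℝ) * b n ^ 4) ^ (1 / 2 : ℝ))) := by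
  -- constants
  set δ : ℝ := η / 10 with hδ
  have hδ0 : 0 < δ := by positivity
  obtain ⟨K', hK'⟩ := hLB δ hδ0
  set K₁ : ℝ := max K' 0 with hK₁
  have hK₁0 : 0 ≤ K₁ := le_max_right _ _
  have hK₁b : ∀ C' D' N R : ℝ, 1 ≤ C' → 1 ≤ D' → 1 ≤ N → 1 / 2 ≤ R →
      ∀ B : ℕ → ℕ → ℕ → ℂ,
        ‖dispK (fun c d => plateau2 (c / C') (d / D')) ⌊5 / 4 * C'⌋₊ ⌊5 / 4 * D'⌋₊ ⌊N⌋₊ R (1 / 2) B‖ ≤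
          K₁ * (C' * D' * N * R * (1 / 2)) ^ δ * lemma1I C' D' N R (1 / 2) *
            lemma1Norm ⌊N⌋₊ R (1 / 2) B := by
    intro C' D' N R h1 h2 h3 h4 B
    refine (hK' C' D' N R h1 h2 h3 h4 B).trans ?_
    have hx : 0 ≤ (C' * D' * N * R * (1 / 2)) ^ δ * lemma1I C' D' N R (1 / 2) *
        lemma1Norm ⌊N⌋₊ R (1 / 2) B := by
      have : 0 ≤ lemma1I C' D' N R (1 / 2) := Real.sqrt_nonneg _
      have : 0 ≤ lemma1Norm ⌊N⌋₊ R (1 / 2) B := Real.sqrt_nonneg _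
      have : 0 ≤ (C' * D' * N * R * (1 / 2)) ^ δ := Real.rpow_nonneg (by positivity) _
      positivity
    calc K' * (C' * D' * N * R * (1 / 2)) ^ δ * lemma1I C' D' N R (1 / 2) * lemma1Norm ⌊N⌋₊ R (1 / 2) B
        = K' * ((C' * D' * N * R * (1 / 2)) ^ δ * lemma1I C' D' N R (1 / 2) *
            lemma1Norm ⌊N⌋₊ R (1 / 2) B) := by ring
      _ ≤ K₁ * ((C' * D' * N * R * (1 / 2)) ^ δ * lemma1I C' D' N R (1 / 2) *
            lemma1Norm ⌊N⌋₊ R (1 / 2) B) :=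
          mul_le_mul_of_nonneg_right (le_max_left _ _) hx
      _ = _ := by ring
  obtain ⟨Cδ, hCδ1, hτ⟩ := exists_card_divisors_le_mul_rpow' hδ0
  have hlog2 : 0 < Real.log 2 := Real.log_pos one_lt_two
  set c₁ : ℝ := 1 / (δ * Real.log 2) + 2 with hc₁
  have hc₁0 : 0 ≤ c₁ := by positivity
  set c₂ : ℝ := 1 + 1 / δ with hc₂
  have hc₂0 : 0 ≤ c₂ := by positivity
  have hA' : (1 : ℝ) ≤ (A : ℝ) := by exact_mod_cast hA
  set V₁ : ℝ := K₁ * (4 * (A : ℝ)) ^ δ * Real.sqrt (16 * A) *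
    Real.sqrt (3 * Cδ ^ 3 * (2 * (A : ℝ)) ^ δ * c₂) with hV₁
  have hV₁0 : 0 ≤ V₁ := by positivity
  refine ⟨c₁ ^ 2 * (25 / 4 * c₂ * Cδ) + 2 * c₁ ^ 3 * V₁, ?_⟩
  intro m hm C D K H N hC hD hK hH hN b β hβ
  obtain ⟨hP1, hCP, hDP, hKHNP, hNP⟩ := L6.one_le_P hC hD hK hH hN
  have hP0 : 0 < C * D * K * H * N := by linarith
  -- the natural-number parameters
  have hK₀1 : 1 ≤ ⌊K⌋₊ := Nat.le_floor (by exact_mod_cast hK)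
  have hH₀1 : 1 ≤ ⌊H⌋₊ := Nat.le_floor (by exact_mod_cast hH)
  have hN₀1 : 1 ≤ ⌊N⌋₊ := Nat.le_floor (by exact_mod_cast hN)
  have hC₀1 : 1 ≤ ⌊C⌋₊ := Nat.le_floor (by exact_mod_cast hC)
  have hD₀1 : 1 ≤ ⌊D⌋₊ := Nat.le_floor (by exact_mod_cast hD)
  have hK₀le : (⌊K⌋₊ : ℝ) ≤ K := Nat.floor_le (by linarith)
  have hH₀le : (⌊H⌋₊ : ℝ) ≤ H := Nat.floor_le (by linarith)
  have hN₀le : (⌊N⌋₊ : ℝ) ≤ N := Nat.floor_le (by linarith)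
  have hC₀le : (⌊C⌋₊ : ℝ) ≤ C := Nat.floor_le (by linarith)
  have hD₀le : (⌊D⌋₊ : ℝ) ≤ D := Nat.floor_le (by linarith)
  set L := Nat.log 2 (⌊N⌋₊ * ⌊N⌋₊) + 1 with hL
  have hNN1 : 1 ≤ ⌊N⌋₊ * ⌊N⌋₊ := by nlinarith
  have hNL : ⌊N⌋₊ * ⌊N⌋₊ ≤ 2 ^ L := (Nat.lt_pow_succ_log_self one_lt_two _).le
  have hNNle : ((⌊N⌋₊ * ⌊N⌋₊ : ℕ) : ℝ) ≤ N ^ 2 := by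
    push_cast
    nlinarith [Nat.cast_nonneg (α := ℝ) ⌊N⌋₊]
  have h2L : ((2 ^ L : ℕ) : ℝ) ≤ 2 * N ^ 2 := by
    have h1 : 2 ^ L ≤ 2 * (⌊N⌋₊ * ⌊N⌋₊) := by
      rw [hL, pow_succ']
      exact Nat.mul_le_mul_left 2 (Nat.pow_log_le_self 2 (by omega))
    calc ((2 ^ L : ℕ) : ℝ) ≤ ((2 * (⌊N⌋₊ * ⌊N⌋₊) : ℕ) : ℝ) := by exact_mod_cast h1
      _ = 2 * ((⌊N⌋₊ * ⌊N⌋₊ : ℕ) : ℝ) := by push_cast; ring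
      _ ≤ 2 * N ^ 2 := by linarith
  have hlogN : 1 + Real.log (⌊N⌋₊ : ℝ) ≤ c₂ * (C * D * K * H * N) ^ δ :=
    one_add_log_le_rpow hP1 (hN₀le.trans hNP) hδ0
  -- abbreviations for the target pieces
  set S₂ := ∑ n ∈ Icc 1 ⌊N⌋₊, b n ^ 2 with hS₂
  have hS₂0 : 0 ≤ S₂ := Finset.sum_nonneg fun n _ => sq_nonneg _
  set W := (H ^ 2 * (H * K + N) * ∑ n ∈ Icc 1 ⌊N⌋₊, (rho n : ℝ) * b n ^ 4) ^ (1 / 2 : ℝ) with hWdef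
  have hW0 : 0 ≤ W := Real.rpow_nonneg (mul_nonneg (by positivity)
    (Finset.sum_nonneg fun n _ => mul_nonneg (Nat.cast_nonneg _) (by positivity))) _
  set Br := (bracket7 C D K H N) ^ (1 / 2 : ℝ) with hBrdef
  have hBr0 : 0 ≤ Br :=
    Real.rpow_nonneg (bracket7_nonneg (by linarith) (by linarith) (by linarith) (by linarith) (by linarith)) _
  have hPδ1 : 1 ≤ (C * D * K * H * N) ^ δ := Real.one_le_rpow hP1 hδ0.le
  set X := C * D * H * K with hX
  have hX0 : 0 ≤ X := by rw [hX]; positivity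
  -- the uniform block bound
  have hblock : ∀ i ∈ Finset.range (Nat.log 2 ⌊C⌋₊ + 1 + 1), ∀ j ∈ Finset.range (Nat.log 2 ⌊D⌋₊ + 1 + 1),
      blockB (A : ℤ) m (fun c d => plateau2 (c / (2 : ℝ) ^ i) (d / (2 : ℝ) ^ j))
        ⌊5 / 4 * (2 : ℝ) ^ i⌋₊ ⌊5 / 4 * (2 : ℝ) ^ j⌋₊ ⌊K⌋₊ ⌊H⌋₊ ⌊N⌋₊ β ≤
        25 / 4 * c₂ * Cδ * X * ((C * D * K * H * N) ^ δ * (C * D * K * H * N) ^ δ) * S₂ +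
          2 * (((L + 1 : ℕ) : ℝ) * (V₁ * ((C * D * K * H * N) ^ (3 * δ) * (C * D * K * H * N) ^ (3 * δ)) *
            Br * W)) := by
    intro i hi j hj
    have hi' : (2 : ℝ) ^ i ≤ 2 * C := L6.two_pow_le_of_mem_range hC hi
    have hj' : (2 : ℝ) ^ j ≤ 2 * D := L6.two_pow_le_of_mem_range hD hj
    have h1i : (1 : ℝ) ≤ (2 : ℝ) ^ i := one_le_pow₀ (by norm_num)
    have h1j : (1 : ℝ) ≤ (2 : ℝ) ^ j := one_le_pow₀ (by norm_num)
    have hb := blockB_le_of_K1half hK₁0 hK₁b hA hm hK₀1 hH₀1 hN₀1 h1i h1j hβ hNL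
    refine hb.trans (add_le_add ?_ (mul_le_mul_of_nonneg_left ?_ zero_le_two))
    · exact diag_block_le b hCδ1 hδ0 hτ hC hD hK hH hN hK₀le hH₀le hN₀le hlogN hc₂0 (by positivity) hi'
        (by positivity) hj'
    · have hNk0 : (0 : ℝ) ≤ ((A * ⌊K⌋₊ * (⌊H⌋₊ * ⌊N⌋₊) : ℕ) : ℝ) := Nat.cast_nonneg _
      have hNk : ((A * ⌊K⌋₊ * (⌊H⌋₊ * ⌊N⌋₊) : ℕ) : ℝ) ≤ (A : ℝ) * (K * H * N) := by
        push_cast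
        have : (⌊K⌋₊ : ℝ) * (⌊H⌋₊ * ⌊N⌋₊) ≤ K * (H * N) := by gcongr
        calc (A : ℝ) * ⌊K⌋₊ * (⌊H⌋₊ * ⌊N⌋₊) = A * (⌊K⌋₊ * (⌊H⌋₊ * ⌊N⌋₊)) := by ring
          _ ≤ A * (K * (H * N)) := mul_le_mul_of_nonneg_left this (by positivity)
          _ = A * (K * H * N) := by ring
      have hl : ∀ l ∈ Finset.range (L + 1),
          K₁ * ((2 : ℝ) ^ i * (2 : ℝ) ^ j * ((A * ⌊K⌋₊ * (⌊H⌋₊ * ⌊N⌋₊) : ℕ) : ℝ) * ((2 : ℝ) ^ l / 2) * (1 / 2)) ^ δ *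
            lemma1I ((2 : ℝ) ^ i) ((2 : ℝ) ^ j) ((A * ⌊K⌋₊ * (⌊H⌋₊ * ⌊N⌋₊) : ℕ) : ℝ) ((2 : ℝ) ^ l / 2) (1 / 2) *
            Real.sqrt (∑ y ∈ Icc 1 (A * ⌊K⌋₊ * (⌊H⌋₊ * ⌊N⌋₊)) ×ˢ Icc 1 (2 ^ L),
              ‖BcoefB A m β ⌊K⌋₊ ⌊H⌋₊ ⌊N⌋₊ y‖ ^ 2) ≤
          V₁ * ((C * D * K * H * N) ^ (3 * δ) * (C * D * K * H * N) ^ (3 * δ)) * Br * W := by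
        intro l hl
        have hlL : l ≤ L := Nat.lt_succ_iff.1 (Finset.mem_range.1 hl)
        have hR0 : (0 : ℝ) ≤ (2 : ℝ) ^ l / 2 := by positivity
        have hR : (2 : ℝ) ^ l / 2 ≤ 2 * N ^ 2 := by
          have h1 : ((2 ^ l : ℕ) : ℝ) ≤ ((2 ^ L : ℕ) : ℝ) := by
            exact_mod_cast Nat.pow_le_pow_right (by norm_num) hlL
          push_cast at h1 h2L
          have : (0 : ℝ) ≤ N ^ 2 := sq_nonneg _
          linarith
        have e1 := eps_factor_le7 hA' hC hD hK hH hN (by positivity) hi' (by positivity) hj'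
          hNk0 hNk hR0 hR hδ0.le
        have e2 := lemma1I_le7 hA' hC hD hK hH hN (by positivity) hi' (by positivity) hj'
          hNk0 hNk hR0 hR
        have e3 := sqrt_boxsumB_le (m := m) hA hK₀1 hH₀1 hβ hCδ1 hδ0 hτ hC hD hK hH hN hK₀le hH₀le hN₀le
          hlogN hc₂0 h2L
        have hI0 : 0 ≤ lemma1I ((2 : ℝ) ^ i) ((2 : ℝ) ^ j) ((A * ⌊K⌋₊ * (⌊H⌋₊ * ⌊N⌋₊) : ℕ) : ℝ)
            ((2 : ℝ) ^ l / 2) (1 / 2) := Real.sqrt_nonneg _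
        calc K₁ * ((2 : ℝ) ^ i * (2 : ℝ) ^ j * ((A * ⌊K⌋₊ * (⌊H⌋₊ * ⌊N⌋₊) : ℕ) : ℝ) * ((2 : ℝ) ^ l / 2) * (1 / 2)) ^ δ *
              lemma1I ((2 : ℝ) ^ i) ((2 : ℝ) ^ j) ((A * ⌊K⌋₊ * (⌊H⌋₊ * ⌊N⌋₊) : ℕ) : ℝ) ((2 : ℝ) ^ l / 2) (1 / 2) *
              Real.sqrt (∑ y ∈ Icc 1 (A * ⌊K⌋₊ * (⌊H⌋₊ * ⌊N⌋₊)) ×ˢ Icc 1 (2 ^ L),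
                ‖BcoefB A m β ⌊K⌋₊ ⌊H⌋₊ ⌊N⌋₊ y‖ ^ 2)
            ≤ K₁ * ((4 * (A : ℝ)) ^ δ * (C * D * K * H * N) ^ (3 * δ)) *
              (Real.sqrt (16 * A) * Br) *
              (Real.sqrt (3 * Cδ ^ 3 * (2 * A) ^ δ * c₂) * (C * D * K * H * N) ^ (3 * δ) * W) := by
              gcongr
          _ = V₁ * ((C * D * K * H * N) ^ (3 * δ) * (C * D * K * H * N) ^ (3 * δ)) * Br * W := by
              rw [hV₁]; ring
      calc ∑ l ∈ Finset.range (L + 1),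
            K₁ * ((2 : ℝ) ^ i * (2 : ℝ) ^ j * ((A * ⌊K⌋₊ * (⌊H⌋₊ * ⌊N⌋₊) : ℕ) : ℝ) * ((2 : ℝ) ^ l / 2) * (1 / 2)) ^ δ *
              lemma1I ((2 : ℝ) ^ i) ((2 : ℝ) ^ j) ((A * ⌊K⌋₊ * (⌊H⌋₊ * ⌊N⌋₊) : ℕ) : ℝ) ((2 : ℝ) ^ l / 2) (1 / 2) *
              Real.sqrt (∑ y ∈ Icc 1 (A * ⌊K⌋₊ * (⌊H⌋₊ * ⌊N⌋₊)) ×ˢ Icc 1 (2 ^ L),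
                ‖BcoefB A m β ⌊K⌋₊ ⌊H⌋₊ ⌊N⌋₊ y‖ ^ 2)
          ≤ ∑ l ∈ Finset.range (L + 1),
              V₁ * ((C * D * K * H * N) ^ (3 * δ) * (C * D * K * H * N) ^ (3 * δ)) * Br * W :=
            Finset.sum_le_sum hl
        _ = _ := by rw [Finset.sum_const, Finset.card_range, nsmul_eq_mul]
  -- sum over the blocks
  have hB1 := dispBm_le_sum_blockB (A : ℤ) m C D K H N β
  set U : ℝ := 25 / 4 * c₂ * Cδ * X * ((C * D * K * H * N) ^ δ * (C * D * K * H * N) ^ δ) * S₂ +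
    2 * (((L + 1 : ℕ) : ℝ) * (V₁ * ((C * D * K * H * N) ^ (3 * δ) * (C * D * K * H * N) ^ (3 * δ)) *
      Br * W)) with hU
  have hB2 : dispBm (A : ℤ) m C D K H N β ≤
      ((Nat.log 2 ⌊C⌋₊ + 1 + 1 : ℕ) : ℝ) * (((Nat.log 2 ⌊D⌋₊ + 1 + 1 : ℕ) : ℝ) * U) := by
    refine hB1.trans ?_
    calc ∑ i ∈ Finset.range (Nat.log 2 ⌊C⌋₊ + 1 + 1), ∑ j ∈ Finset.range (Nat.log 2 ⌊D⌋₊ + 1 + 1),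
          blockB (A : ℤ) m (fun c d => plateau2 (c / (2 : ℝ) ^ i) (d / (2 : ℝ) ^ j))
            ⌊5 / 4 * (2 : ℝ) ^ i⌋₊ ⌊5 / 4 * (2 : ℝ) ^ j⌋₊ ⌊K⌋₊ ⌊H⌋₊ ⌊N⌋₊ β
        ≤ ∑ i ∈ Finset.range (Nat.log 2 ⌊C⌋₊ + 1 + 1), ∑ j ∈ Finset.range (Nat.log 2 ⌊D⌋₊ + 1 + 1), U :=
          Finset.sum_le_sum fun i hi => Finset.sum_le_sum fun j hj => hblock i hi j hj
      _ = _ := by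
          rw [Finset.sum_const, Finset.card_range, nsmul_eq_mul, Finset.sum_const, Finset.card_range,
            nsmul_eq_mul]
  -- the counting factors
  have hcC : ((Nat.log 2 ⌊C⌋₊ + 1 + 1 : ℕ) : ℝ) ≤ c₁ * (C * D * K * H * N) ^ δ := by
    have h := L6.natLog_two_add_two_le hC₀1 hC₀le hδ0
    push_cast at h ⊢
    refine (by linarith : (Nat.log 2 ⌊C⌋₊ : ℝ) + 1 + 1 ≤ (1 / (δ * Real.log 2) + 2) * C ^ δ).trans ?_
    exact mul_le_mul_of_nonneg_left (Real.rpow_le_rpow (by linarith) hCP hδ0.le) hc₁0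
  have hcD : ((Nat.log 2 ⌊D⌋₊ + 1 + 1 : ℕ) : ℝ) ≤ c₁ * (C * D * K * H * N) ^ δ := by
    have h := L6.natLog_two_add_two_le hD₀1 hD₀le hδ0
    push_cast at h ⊢
    refine (by linarith : (Nat.log 2 ⌊D⌋₊ : ℝ) + 1 + 1 ≤ (1 / (δ * Real.log 2) + 2) * D ^ δ).trans ?_
    exact mul_le_mul_of_nonneg_left (Real.rpow_le_rpow (by linarith) hDP hδ0.le) hc₁0
  have hcL : ((L + 1 : ℕ) : ℝ) ≤ c₁ * (C * D * K * H * N) ^ (2 * δ) := by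
    have h := L6.natLog_two_add_two_le (x := N ^ 2) hNN1 hNNle hδ0
    rw [hL]
    push_cast at h ⊢
    refine (by linarith : (Nat.log 2 (⌊N⌋₊ * ⌊N⌋₊) : ℝ) + 1 + 1 ≤ (1 / (δ * Real.log 2) + 2) * (N ^ 2) ^ δ).trans ?_
    have e : (N ^ 2) ^ δ = N ^ (2 * δ) := by
      rw [← Real.rpow_natCast, ← Real.rpow_mul (by linarith)]; norm_num
    rw [e]
    exact mul_le_mul_of_nonneg_left (Real.rpow_le_rpow (by linarith) hNP (by positivity)) hc₁0
  -- powers of `p = P^δ`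
  set p : ℝ := (C * D * K * H * N) ^ δ with hp
  have hp1 : 1 ≤ p := hPδ1
  have hp0 : 0 ≤ p := by linarith
  have hp2 : (C * D * K * H * N) ^ (2 * δ) = p ^ 2 := by
    rw [hp, ← Real.rpow_natCast, ← Real.rpow_mul hP0.le]; ring_nf
  have hp3 : (C * D * K * H * N) ^ (3 * δ) = p ^ 3 := by
    rw [hp, ← Real.rpow_natCast, ← Real.rpow_mul hP0.le]; ring_nf
  have hpη : (C * D * K * H * N) ^ η = p ^ 10 := by
    rw [hp, ← Real.rpow_natCast, ← Real.rpow_mul hP0.le, hδ]; ring_nf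
  rw [hp3] at hU
  rw [hp2] at hcL
  rw [hpη]
  -- `U ≤ (25/4)c₂Cδ X p² S₂ + 2 c₁ p² V₁ p⁶ Br W`
  have hU1 : U ≤ 25 / 4 * c₂ * Cδ * X * (p * p) * S₂ + 2 * (c₁ * p ^ 2 * (V₁ * (p ^ 3 * p ^ 3) * Br * W)) := by
    rw [hU]
    have hx : 0 ≤ V₁ * (p ^ 3 * p ^ 3) * Br * W := by positivity
    nlinarith [mul_le_mul_of_nonneg_right hcL hx]
  have hU0 : 0 ≤ U := by rw [hU]; positivity
  -- `dispBm ≤ (c₁ p)(c₁ p) U`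
  have hB3 : dispBm (A : ℤ) m C D K H N β ≤ (c₁ * p) * ((c₁ * p) * U) := by
    refine hB2.trans ?_
    have h2 : ((Nat.log 2 ⌊D⌋₊ + 1 + 1 : ℕ) : ℝ) * U ≤ (c₁ * p) * U := mul_le_mul_of_nonneg_right hcD hU0
    calc ((Nat.log 2 ⌊C⌋₊ + 1 + 1 : ℕ) : ℝ) * (((Nat.log 2 ⌊D⌋₊ + 1 + 1 : ℕ) : ℝ) * U)
        ≤ ((Nat.log 2 ⌊C⌋₊ + 1 + 1 : ℕ) : ℝ) * ((c₁ * p) * U) :=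
          mul_le_mul_of_nonneg_left h2 (Nat.cast_nonneg _)
      _ ≤ (c₁ * p) * ((c₁ * p) * U) := mul_le_mul_of_nonneg_right hcC (by positivity)
  refine hB3.trans ?_
  -- polynomial bookkeeping in `p ≥ 1`
  have hp4le : p ^ 4 ≤ p ^ 10 := pow_le_pow_right₀ hp1 (by norm_num)
  have hCδ0 : 0 ≤ Cδ := by linarith
  have hBW : 0 ≤ Br * W := mul_nonneg hBr0 hW0
  have hXS : 0 ≤ X * S₂ := mul_nonneg hX0 hS₂0
  calc (c₁ * p) * ((c₁ * p) * U)
      ≤ (c₁ * p) * ((c₁ * p) * (25 / 4 * c₂ * Cδ * X * (p * p) * S₂ +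
          2 * (c₁ * p ^ 2 * (V₁ * (p ^ 3 * p ^ 3) * Br * W)))) := by
        gcongr
    _ = c₁ ^ 2 * (25 / 4 * c₂ * Cδ) * (p ^ 4 * (X * S₂)) + 2 * c₁ ^ 3 * V₁ * (p ^ 10 * (Br * W)) := by ring
    _ ≤ c₁ ^ 2 * (25 / 4 * c₂ * Cδ) * (p ^ 10 * (X * S₂)) + 2 * c₁ ^ 3 * V₁ * (p ^ 10 * (Br * W)) := by
        gcongr
    _ ≤ (c₁ ^ 2 * (25 / 4 * c₂ * Cδ) + 2 * c₁ ^ 3 * V₁) * (p ^ 10 * (X * S₂)) +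
          (c₁ ^ 2 * (25 / 4 * c₂ * Cδ) + 2 * c₁ ^ 3 * V₁) * (p ^ 10 * (Br * W)) := by
        have h1 : 0 ≤ 2 * c₁ ^ 3 * V₁ * (p ^ 10 * (X * S₂)) := by positivity
        have h2 : 0 ≤ c₁ ^ 2 * (25 / 4 * c₂ * Cδ) * (p ^ 10 * (Br * W)) := by positivity
        nlinarith
    _ = (c₁ ^ 2 * (25 / 4 * c₂ * Cδ) + 2 * c₁ ^ 3 * V₁) * (p ^ 10 * (X * S₂ + Br * W)) := by ring


/-- **BFI Lemma 7 for `𝓑_m` and any `a ≠ 0` from the `S = 1/2` instance of Lemma 1** (§9, (9.15),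
pp. 230–231), with the bracket of (9.15) spelled out (both signs of `a`, via `BFI.L7.dispBm_neg`).
[cite: BombieriFriedlanderIwaniecActa1986, §9 Lemma 7 p. 230] -/
theorem dispBm_le_of_K1half (hLB : K1HalfFor plateau2 (5 / 4)) :
    ∀ a : ℤ, a ≠ 0 → ∀ η : ℝ, 0 < η → ∃ C₇ : ℝ, ∀ m : ℕ, 0 < m → ∀ C D K H N : ℝ,
      1 ≤ C → 1 ≤ D → 1 ≤ K → 1 ≤ H → 1 ≤ N → ∀ (b : ℕ → ℝ) (β : ℕ → ℕ → ℂ),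
        (∀ h n, ‖β h n‖ ≤ |b n|) →
          dispBm a m C D K H N β ≤
            C₇ * ((C * D * K * H * N) ^ η * (C * D * H * K * ∑ n ∈ Icc 1 ⌊N⌋₊, b n ^ 2 +
              (bracket7 C D K H N) ^ (1 / 2 : ℝ) *
                (H ^ 2 * (H * K + N) * ∑ n ∈ Icc 1 ⌊N⌋₊, (rho n : ℝ) * b n ^ 4) ^ (1 / 2 : ℝ))) := by
  intro a ha η hη
  have hA : 1 ≤ a.natAbs := Int.natAbs_pos.2 ha
  obtain ⟨C₇, hC₇⟩ := dispBm_le_pos_half hLB hA hη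
  refine ⟨C₇, fun m hm C D K H N hC hD hK hH hN b β hβ => ?_⟩
  rcases le_or_gt 0 a with h0 | h0
  · have e : a = (a.natAbs : ℤ) := (Int.natAbs_of_nonneg h0).symm
    rw [e]
    exact hC₇ m hm C D K H N hC hD hK hH hN b β hβ
  · have e : a = -(a.natAbs : ℤ) := by
      rw [Int.ofNat_natAbs_of_nonpos h0.le]; ring
    rw [e, dispBm_neg _ hm]
    refine hC₇ m hm C D K H N hC hD hK hH hN b (fun h n => conj (β h n)) fun h n => ?_
    rw [Complex.norm_conj]
    exact hβ h n

end L7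

/-! ### Lemma 7 in the shape consumed by `BombieriFriedlanderIwaniecTheorem2_of_lemma7` -/

/-- **BFI 1986, Lemma 7 (§9, (9.15), p. 230) for `𝓑_m`, from the `S = 1/2` instance of Lemma 1**,
in exactly the shape of the hypothesis `h7` of `BFI.BombieriFriedlanderIwaniecTheorem2_of_lemma7`.
[cite: BombieriFriedlanderIwaniecActa1986, §9 Lemma 7 pp. 230–231] -/
theorem lemma7_dispBm_of_K1half (hLB : K1HalfFor plateau2 (5 / 4)) :
    ∀ a : ℤ, a ≠ 0 → ∀ η : ℝ, 0 < η → ∃ C₇ : ℝ, ∀ m : ℕ, 0 < m → ∀ C D K H N' : ℝ,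
      1 ≤ C → 1 ≤ D → 1 ≤ K → 1 ≤ H → 1 ≤ N' → ∀ (b : ℕ → ℝ) (β' : ℕ → ℕ → ℂ),
        (∀ h n, ‖β' h n‖ ≤ |b n|) →
          dispBm a m C D K H N' β' ≤ C₇ * lemma7Rhs C D K H N' η
            (∑ n ∈ Icc 1 ⌊N'⌋₊, b n ^ 2) (∑ n ∈ Icc 1 ⌊N'⌋₊, (rho n : ℝ) * b n ^ 4) := by
  intro a ha η hη
  obtain ⟨C₇, hC₇⟩ := L7.dispBm_le_of_K1half hLB a ha η hη
  refine ⟨C₇, fun m hm C D K H N hC hD hK hH hN b β hβ => ?_⟩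
  rw [L7.lemma7Rhs_eq]
  exact hC₇ m hm C D K H N hC hD hK hH hN b β hβ

/-- **BFI Lemma 7 for `𝓑_m` from the CORRECTED Lemma 1** (BFI 2019, Lemma 2.1) for the weight `w ⊗ w`.
[cite: BombieriFriedlanderIwaniec2019, §2 Lemma 2.1; BombieriFriedlanderIwaniecActa1986, §9 Lemma 7 pp. 230–231] -/
theorem lemma7_dispBm_of_lemma1corr (h : Lemma1BoundCorrected plateau2 (5 / 4)) :
    ∀ a : ℤ, a ≠ 0 → ∀ η : ℝ, 0 < η → ∃ C₇ : ℝ, ∀ m : ℕ, 0 < m → ∀ C D K H N' : ℝ,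
      1 ≤ C → 1 ≤ D → 1 ≤ K → 1 ≤ H → 1 ≤ N' → ∀ (b : ℕ → ℝ) (β' : ℕ → ℕ → ℂ),
        (∀ h n, ‖β' h n‖ ≤ |b n|) →
          dispBm a m C D K H N' β' ≤ C₇ * lemma7Rhs C D K H N' η
            (∑ n ∈ Icc 1 ⌊N'⌋₊, b n ^ 2) (∑ n ∈ Icc 1 ⌊N'⌋₊, (rho n : ℝ) * b n ^ 4) :=
  lemma7_dispBm_of_K1half (k1Half_of_corrected h)

/-! ### Theorem 2, Theorem 10 (dyadic, printed, `π`-form), the level fact and Corollary 2 -/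

/-- **BFI Theorem 2 (§9, p. 230) from the `S = 1/2` instance of Lemma 1.**
[cite: BombieriFriedlanderIwaniecActa1986, §9 Theorem 2 p. 230] -/
theorem theorem2_of_k1Half (h : K1HalfFor plateau2 (5 / 4)) : BombieriFriedlanderIwaniecTheorem2 :=
  BombieriFriedlanderIwaniecTheorem2_of_lemma7 (lemma7_dispBm_of_K1half h)

/-- **The dyadic form of BFI Theorem 10 ((15.1), p. 244) from the `S = 1/2` instance of Lemma 1.**
[cite: BombieriFriedlanderIwaniecActa1986, §15 (15.1) p. 244; §8 p. 227, §9 p. 231] -/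
theorem Theorem10Dyadic_of_k1Half (h : K1HalfFor plateau2 (5 / 4)) : Theorem10Dyadic :=
  Theorem10Dyadic_of_theorem1_theorem2_theorem5 (BombieriFriedlanderIwaniecTheorem1_of_k1Half h)
    (theorem2_of_k1Half h) (BombieriFriedlanderIwaniecTheorem5_of_k1Half h)

/-- **The dyadic form of BFI Theorem 10 ((15.1), p. 244, for the weights of Theorem 10) from the
CORRECTED Lemma 1** (BFI 2019, Lemma 2.1) for the weight `w ⊗ w`: Theorems 1, 2, 5 being theorems
of the tree conditionally on that single (true, published) bound.  Supersedes
`BFI.Theorem10Dyadic_of_lemma1` (misprinted, false hypothesis).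
[cite: BombieriFriedlanderIwaniec2019, §2 Lemma 2.1; BombieriFriedlanderIwaniecActa1986, §15 (15.1) p. 244] -/
theorem Theorem10Dyadic_of_lemma1corr (h : Lemma1BoundCorrected plateau2 (5 / 4)) : Theorem10Dyadic :=
  Theorem10Dyadic_of_k1Half (k1Half_of_corrected h)

end BFI

open BFI

/-- **BFI 1986, Theorem 2 (§9, p. 230) from the CORRECTED Lemma 1** (BFI 2019, Lemma 2.1), for the
weight `w ⊗ w`: Lemma 7 from its `S = 1/2` instance (this file) and
`BFI.BombieriFriedlanderIwaniecTheorem2_of_lemma7` (tree).  Supersedes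
`BombieriFriedlanderIwaniecTheorem2_of_lemma1` (misprinted hypothesis).
[cite: BombieriFriedlanderIwaniec2019, §2 Lemma 2.1; BombieriFriedlanderIwaniecActa1986, §9 Theorem 2 p. 230] -/
theorem BombieriFriedlanderIwaniecTheorem2_of_lemma1corr (h : BFI.Lemma1BoundCorrected BFI.plateau2 (5 / 4)) :
    BombieriFriedlanderIwaniecTheorem2 :=
  BFI.theorem2_of_k1Half (BFI.k1Half_of_corrected h)

/-- **BFI Theorem 10 as printed (p. 209: level `x^{4/7−ε}` for well-factorable weights, `ψ`-form)
from the CORRECTED Lemma 1** (BFI 2019, Lemma 2.1), for the weight `w ⊗ w`: the complete reduction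
of the source's main theorem to its single external input, the corrected Theorem 12 of
Deshouillers–Iwaniec.  Supersedes `BombieriFriedlanderIwaniecTheorem10_of_lemma1`.
[cite: BombieriFriedlanderIwaniec2019, §2 Lemma 2.1; BombieriFriedlanderIwaniecActa1986, Theorem 10 p. 209] -/
theorem BombieriFriedlanderIwaniecTheorem10_of_lemma1corr (h : BFI.Lemma1BoundCorrected BFI.plateau2 (5 / 4)) :
    BombieriFriedlanderIwaniecTheorem10 :=
  BombieriFriedlanderIwaniecTheorem10_of_theorem1_theorem2_theorem5
    (BombieriFriedlanderIwaniecTheorem1_of_lemma1corr h) (BombieriFriedlanderIwaniecTheorem2_of_lemma1corr h)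
    (BombieriFriedlanderIwaniecTheorem5_of_lemma1corr h)

/-- **BFI Theorem 10 as printed from the `S = 1/2` instance of Lemma 1 alone.**
[cite: BombieriFriedlanderIwaniecActa1986, Theorem 10 p. 209] -/
theorem BombieriFriedlanderIwaniecTheorem10_of_k1Half (h : BFI.K1HalfFor BFI.plateau2 (5 / 4)) :
    BombieriFriedlanderIwaniecTheorem10 :=
  BombieriFriedlanderIwaniecTheorem10_of_theorem1_theorem2_theorem5
    (BombieriFriedlanderIwaniecTheorem1_of_k1Half h) (BFI.theorem2_of_k1Half h)
    (BombieriFriedlanderIwaniecTheorem5_of_k1Half h)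

/-- **The tree's fact `bfi_wellFactorable_level` from the corrected Lemma 1.**
[cite: BombieriFriedlanderIwaniec2019, §2 Lemma 2.1; BombieriFriedlanderIwaniecActa1986, Theorem 10 p. 209] -/
theorem bfi_wellFactorable_level_of_lemma1corr (h : BFI.Lemma1BoundCorrected BFI.plateau2 (5 / 4)) :
    bfi_wellFactorable_level :=
  bfi_wellFactorable_level_of_theorem10 (BombieriFriedlanderIwaniecTheorem10_of_lemma1corr h)

/-- **BFI Theorem 10, `π`-form (the named fact `BombieriFriedlanderIwaniecTheorem10Pi`) from the
corrected Lemma 1**, through `BombieriFriedlanderIwaniecTheorem10Pi_of_theorem10`.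
[cite: BombieriFriedlanderIwaniec2019, §2 Lemma 2.1; BombieriFriedlanderIwaniecActa1986, Theorem 10 p. 209] -/
theorem BombieriFriedlanderIwaniecTheorem10Pi_of_lemma1corr (h : BFI.Lemma1BoundCorrected BFI.plateau2 (5 / 4)) :
    BombieriFriedlanderIwaniecTheorem10Pi :=
  BombieriFriedlanderIwaniecTheorem10Pi_of_theorem10 (BombieriFriedlanderIwaniecTheorem10_of_lemma1corr h)

/-- **BFI 1986, Corollary 2 (`π₂(x) ≤ (7/2 + ε) · 2C₂ x/log²x` for `x ≥ x₀(ε)`; the named fact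
`twinSieve_bfi`) from the CORRECTED Lemma 1**, through `twinSieve_bfi_of_theorem10Pi`.  Supersedes
`twinSieve_bfi_of_lemma1` (misprinted hypothesis).
[cite: BombieriFriedlanderIwaniec2019, §2 Lemma 2.1; BombieriFriedlanderIwaniecActa1986, §1 Corollary 2 p. 209, §17 p. 251] -/
theorem twinSieve_bfi_of_lemma1corr (h : BFI.Lemma1BoundCorrected BFI.plateau2 (5 / 4)) : twinSieve_bfi :=
  twinSieve_bfi_of_theorem10Pi (BombieriFriedlanderIwaniecTheorem10Pi_of_lemma1corr h)

/-- **Corollary 2 from the `S = 1/2` instance of Lemma 1 alone.**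
[cite: BombieriFriedlanderIwaniecActa1986, §1 Corollary 2 p. 209] -/
theorem twinSieve_bfi_of_k1Half (h : BFI.K1HalfFor BFI.plateau2 (5 / 4)) : twinSieve_bfi :=
  twinSieve_bfi_of_theorem10Pi
    (BombieriFriedlanderIwaniecTheorem10Pi_of_theorem10 (BombieriFriedlanderIwaniecTheorem10_of_k1Half h))

/-! ### From the corrected Lemma 1 quantified over all smooth weights (the printed Lemma 2.1) -/

/-- The printed corrected Lemma 1 (all smooth `g₀` supported in a box `[a, b]²`, `0 < a ≤ b`)
contains the instance `g₀ = w ⊗ w`, `[a, b] = [1/4, 5/4]`.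
[cite: BombieriFriedlanderIwaniec2019, §2 Lemma 2.1] -/
theorem BFI.lemma1BoundCorrected_plateau2_of_printed
    (h1 : ∀ g₀ : ℝ → ℝ → ℝ, ContDiff ℝ ∞ (fun p : ℝ × ℝ => g₀ p.1 p.2) →
      ∀ a b : ℝ, 0 < a → a ≤ b →
        (∀ ξ η : ℝ, ¬ (ξ ∈ Set.Icc a b ∧ η ∈ Set.Icc a b) → g₀ ξ η = 0) →
          BFI.Lemma1BoundCorrected g₀ b) :
    BFI.Lemma1BoundCorrected BFI.plateau2 (5 / 4) :=
  h1 BFI.plateau2 BFI.contDiff_plateau2 (1 / 4) (5 / 4) (by norm_num) (by norm_num)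
    fun _ _ h => BFI.plateau2_eq_zero h

/-- **BFI Theorem 10 as printed (p. 209) from the printed corrected Lemma 1** (BFI 2019 Lemma 2.1,
all smooth weights of compact support in `ℝ⁺ × ℝ⁺`, rendered as support in a box `[a, b]²`,
`0 < a ≤ b`). [cite: BombieriFriedlanderIwaniec2019, §2 Lemma 2.1; BombieriFriedlanderIwaniecActa1986, Theorem 10 p. 209] -/
theorem BombieriFriedlanderIwaniecTheorem10_of_lemma1corr'
    (h1 : ∀ g₀ : ℝ → ℝ → ℝ, ContDiff ℝ ∞ (fun p : ℝ × ℝ => g₀ p.1 p.2) →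
      ∀ a b : ℝ, 0 < a → a ≤ b →
        (∀ ξ η : ℝ, ¬ (ξ ∈ Set.Icc a b ∧ η ∈ Set.Icc a b) → g₀ ξ η = 0) →
          BFI.Lemma1BoundCorrected g₀ b) :
    BombieriFriedlanderIwaniecTheorem10 :=
  BombieriFriedlanderIwaniecTheorem10_of_lemma1corr (BFI.lemma1BoundCorrected_plateau2_of_printed h1)

/-- **The dyadic Theorem 10 from the printed corrected Lemma 1.**
[cite: BombieriFriedlanderIwaniec2019, §2 Lemma 2.1; BombieriFriedlanderIwaniecActa1986, §15 (15.1) p. 244] -/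
theorem BFI.Theorem10Dyadic_of_lemma1corr'
    (h1 : ∀ g₀ : ℝ → ℝ → ℝ, ContDiff ℝ ∞ (fun p : ℝ × ℝ => g₀ p.1 p.2) →
      ∀ a b : ℝ, 0 < a → a ≤ b →
        (∀ ξ η : ℝ, ¬ (ξ ∈ Set.Icc a b ∧ η ∈ Set.Icc a b) → g₀ ξ η = 0) →
          BFI.Lemma1BoundCorrected g₀ b) :
    BFI.Theorem10Dyadic :=
  BFI.Theorem10Dyadic_of_lemma1corr (BFI.lemma1BoundCorrected_plateau2_of_printed h1)

/-- **Corollary 2 from the printed corrected Lemma 1.**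
[cite: BombieriFriedlanderIwaniec2019, §2 Lemma 2.1; BombieriFriedlanderIwaniecActa1986, §1 Corollary 2 p. 209] -/
theorem twinSieve_bfi_of_lemma1corr'
    (h1 : ∀ g₀ : ℝ → ℝ → ℝ, ContDiff ℝ ∞ (fun p : ℝ × ℝ => g₀ p.1 p.2) →
      ∀ a b : ℝ, 0 < a → a ≤ b →
        (∀ ξ η : ℝ, ¬ (ξ ∈ Set.Icc a b ∧ η ∈ Set.Icc a b) → g₀ ξ η = 0) →
          BFI.Lemma1BoundCorrected g₀ b) :
    twinSieve_bfi :=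
  twinSieve_bfi_of_lemma1corr (BFI.lemma1BoundCorrected_plateau2_of_printed h1)

end Literature.NumberTheory.Sieve
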